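import Literature.MathematicalPhysics.QuantumFieldTheory.Balaban1983to89.TreeLengthTorusTransfer
import Literature.MathematicalPhysics.QuantumFieldTheory.Balaban1983to89.B16Ineq197ClassOne

/-!
# `Balaban1983to89.B13CubeSumTorus` — T. Bałaban, *Renormalization group approach to lattice gauge field theories.
II. Cluster expansions*, Commun. Math. Phys. **116** (1988) 1–22, doi:10.1007/bf01239022 [Balaban1988RG2Cluster]:
**the □′-sum of p. 9 for the (I.3.7)-type terms, Σ_{□′∈π_j} exp(−½δ₀dist^{(ξ)}(□′, □)) ≤ O₂·(L^jη)⁻⁴, PROVED on the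
papers' periodic carrier** with the absolute constant O₂ = 1344 under δ₀M ≥ 2 log 5

statement-level skeleton of published theorems with citation tags; proofs where landed; nothing here is a claim about
the Yang–Mills mass gap

PDF held: `paper:balaban1988-cmp116-rg-ii-cluster` (journal page = PDF page + 0); pp. 8–9 re-read this session (images
`b2b-balaban-ref1/pages/…-p008-x2.png`, `…-p009-x2.png` + text layer).

CITATION HEADER / WHAT IS REPRODUCED (cell `pub-ymgap`, Track A node N10 = [B13], prover seat `pub-ymgap-dag-p2`,
eleventh module; a NEW LEAF over `TreeLengthTorusTransfer` and `B16Ineq197ClassOne` (boxes `B16Absorption.pbox`),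
nothing there modified).  p. 8 [PDF 8] (after (1.29)), verbatim: *"E₀24B₀²C₁B₃e^{16κ₁}α₂⁻¹ε₁ exp(−½δ₀M(L^jη)⁻¹ −
½δ₀dist^{(ξ)}(X, □))"*; p. 9 [PDF 9]: *"We fix a cube □′ ∈ π_j such, that □′ ⊂ X, dist^{(ξ)}(X, □) =
dist^{(ξ)}(□′, □), and we sum over X containing □′ … Next we sum over the cubes □′, and this sum is controlled by the
first exponential in (1.30)."*  READING (as `B13BlockGeometryTorus`): on the scale-j torus `TPt 4 (m·N)`, m = L^{k−j},
the cover cube □ anchored at the π_k-cube ā is the box of π_j-cubes `pbox (m·ā) (m·ā + 2m − 1)`; a cube □′ of π_j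
outside its enlargement by n + 1 cubes is separated from □ by a gap of ≥ n + 1 cubes, hence at ξ-distance
≥ (n + 1)M from □ (a cube of π_j has side M in ξ-units), which is the ONLY property of dist^{(ξ)} used (`hdist`).
* `image_pbox_eq_univ` — a box one period wide covers the torus; `card_image_marginBox_le` — the enlargement by n of □
  has ≤ (2m + 2n)⁴ cubes of π_j.
* `shell_sum_le` — the shell argument: weights ≤ 1 decaying like r^{n+1}, r ≤ 1/5, off the enlargement by n + 1 sum to
  ≤ 1344·m⁴.
* `cubeSum_p9` — **Σ_{□′∈π_j} exp(−½δ₀dist(□′)) ≤ 1344·m⁴** for every `dist` with dist(□′) ≥ (n + 1)M off the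
  enlargement by n + 1, under δ₀ ≥ 0 and δ₀M ≥ 2 log 5 (then e^{−½δ₀M} ≤ 1/5); `cubeSum_p9_hq` — the same over any
  family `Sq' ⊆ π_j` in the exact shape of the hypothesis `hq'` of `B13Lemma1DepTorus.lemma1Printed_twoTorus_dep` /
  `B13Lemma1BlocksTorus.lemma1Printed_twoTorus_blocks`: `≤ 1344·((L^j(L^k)⁻¹)⁴)⁻¹`.  With this module every COUNT and
  every tree-length statement of the Lemma-1 resummation pp. 7–9 is a theorem of the torus; what stays by reference
  is the analytic content ((1.24), (1.30), analyticity) and the decomposition (1.33) itself.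
HONEST FRAMING: a count-neutral Track-A side landing (YM-PLAN §1); NOT a discharge of node N10; elementary lattice
geometry and series bounds read against the located sentences; nothing continuum / OS / mass-gap / Clay.
-/

noncomputable section

namespace Literature.MathematicalPhysics.QuantumFieldTheory.Balaban1983to89.B13CubeSumTorus

open Literature.MathematicalPhysics.QuantumFieldTheory.Balaban1983to89
open Literature.MathematicalPhysics.QuantumFieldTheory.Balaban1983to89.B13ScaleTransfer (Pt)
open Literature.MathematicalPhysics.QuantumFieldTheory.Balaban1983to89.B16Absorption (pbox mem_pbox)
open Literature.MathematicalPhysics.QuantumFieldTheory.Balaban1983to89.B16Ineq197ClassOne (card_pbox_eq_pow)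
open Literature.MathematicalPhysics.QuantumFieldTheory.Balaban1983to89.TreeLengthTorus
open Literature.MathematicalPhysics.QuantumFieldTheory.Balaban1983to89.TreeLengthTorusGeometry (period proj_add_period)



/-! ## §1. The polynomial–geometric series behind the □′-sum -/

/-- (n + 2)⁴ ≤ 42·(5/2)ⁿ.  Private numeric plumbing. [folklore] -/
private theorem pow4_le_geom (n : ℕ) : ((n : ℝ) + 2) ^ 4 ≤ 42 * (5 / 2 : ℝ) ^ n := by
  induction n with
  | zero => norm_num
  | succ n ih =>
    rcases lt_or_ge n 2 with h | h
    · interval_cases n <;> norm_num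
    · have ht : (4 : ℝ) ≤ (n : ℝ) + 2 := by
        have : (2 : ℝ) ≤ n := by exact_mod_cast h
        linarith
      set t : ℝ := (n : ℝ) + 2 with htdef
      have key : (t + 1) ^ 4 ≤ (5 / 2) * t ^ 4 := by
        have h1 : 6 * t ^ 3 ≤ (3 / 2) * t ^ 4 := by nlinarith [pow_nonneg (by linarith : (0:ℝ) ≤ t) 3]
        have h2 : 8 * t ^ 2 ≤ 2 * t ^ 3 := by nlinarith [pow_nonneg (by linarith : (0:ℝ) ≤ t) 2]
        have h3 : 4 * t + 1 ≤ 2 * t ^ 2 := by nlinarith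
        nlinarith
      calc (((n + 1 : ℕ) : ℝ) + 2) ^ 4 = (t + 1) ^ 4 := by rw [htdef]; push_cast; ring
        _ ≤ (5 / 2) * t ^ 4 := key
        _ ≤ (5 / 2) * (42 * (5 / 2 : ℝ) ^ n) := by rw [htdef]; linarith
        _ = 42 * (5 / 2 : ℝ) ^ (n + 1) := by ring

/-- Σ_{n<K} (n + 2)⁴ rⁿ ≤ 84 for 0 ≤ r ≤ 1/5.  Private numeric plumbing. [folklore] -/
private theorem series_le (K : ℕ) {r : ℝ} (hr0 : 0 ≤ r) (hr : r ≤ 1 / 5) :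
    ∑ n ∈ Finset.range K, ((n : ℝ) + 2) ^ 4 * r ^ n ≤ 84 := by
  have hx : (5 / 2 : ℝ) * r ≤ 1 / 2 := by linarith
  have hx0 : 0 ≤ (5 / 2 : ℝ) * r := by positivity
  calc ∑ n ∈ Finset.range K, ((n : ℝ) + 2) ^ 4 * r ^ n
      ≤ ∑ n ∈ Finset.range K, 42 * ((5 / 2 : ℝ) * r) ^ n := Finset.sum_le_sum fun n _ => by
        rw [mul_pow]
        calc ((n : ℝ) + 2) ^ 4 * r ^ n ≤ 42 * (5 / 2 : ℝ) ^ n * r ^ n :=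
              mul_le_mul_of_nonneg_right (pow4_le_geom n) (pow_nonneg hr0 n)
          _ = 42 * ((5 / 2 : ℝ) ^ n * r ^ n) := by ring
    _ ≤ ∑ n ∈ Finset.range K, 42 * (1 / 2 : ℝ) ^ n := Finset.sum_le_sum fun n _ =>
        mul_le_mul_of_nonneg_left (pow_le_pow_left₀ hx0 hx n) (by norm_num)
    _ = 42 * ∑ n ∈ Finset.range K, (1 / 2 : ℝ) ^ n := by rw [Finset.mul_sum]
    _ ≤ 42 * 2 := by
        refine mul_le_mul_of_nonneg_left ?_ (by norm_num)
        have h := geom_sum_Ico_le_of_lt_one (m := 0) (n := K) (by norm_num : (0:ℝ) ≤ 1 / 2) (by norm_num)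
        rw [← Finset.range_eq_Ico] at h
        refine h.trans ?_
        norm_num
    _ = 84 := by norm_num

/-! ## §2. The boxes of π_j-cubes around the cover cube □ on the scale-j torus -/

variable {d : ℕ}

/-- A box of cubes at least one period wide in every direction covers the torus ([I] p. 251: *"a torus T obtained by
the usual identification of boundary points of the cube"* — every class has a representative in any window of N
consecutive integers). [cite: Balaban1987RG1, p.251 (torus identification of the cube lattice)] -/
theorem image_pbox_eq_univ (P : ℕ) [NeZero P] {lo hi : Pt d} (h : ∀ i, lo i + P ≤ hi i + 1) :
    (pbox lo hi).image (proj P) = Finset.univ := by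
  classical
  refine Finset.eq_univ_of_forall fun q => ?_
  have hP : (0 : ℤ) < P := by exact_mod_cast Nat.pos_of_ne_zero (NeZero.ne P)
  -- the representative of q in the box
  refine Finset.mem_image.mpr ⟨fun i => lo i + (natLift q i - lo i) % (P : ℤ), mem_pbox.mpr fun i => ⟨?_, ?_⟩, ?_⟩
  · have := Int.emod_nonneg (natLift q i - lo i) hP.ne'
    linarith
  · have := Int.emod_lt_of_pos (natLift q i - lo i) hP
    have := h i
    linarith
  · have e : (fun i => lo i + (natLift q i - lo i) % (P : ℤ)) =
        natLift q + period P (fun i => -((natLift q i - lo i) / (P : ℤ))) := by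
      funext i
      simp only [Pi.add_apply, period]
      have := Int.mul_ediv_add_emod (natLift q i - lo i) (P : ℤ)
      linarith
    rw [e, proj_add_period, proj_natLift]

/-- On the scale-j torus (m = L^{k−j} cubes of π_j per cube of π_k and direction) the cover cube □ anchored at the
π_k-cube ā is the box `pbox (m·ā) (m·ā + 2m − 1)` of π_j-cubes; its enlargement by n cubes of π_j on every side has
at most (2m + 2n)^d cubes ([II] p. 9: the cubes □′ ∈ π_j at ξ-distance < n·M from □ lie in it).
[cite: Balaban1988RG2Cluster, p.9 (the sum over the cubes □′)] -/
theorem card_image_marginBox_le (P : ℕ) (m : ℕ) (a : Pt d) (n : ℕ) :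
    ((pbox (fun i => (m : ℤ) * a i - n) (fun i => (m : ℤ) * a i + 2 * m - 1 + n)).image (proj P)).card ≤
      (2 * m + 2 * n) ^ d :=
  Finset.card_image_le.trans (card_pbox_eq_pow (N := 2 * m + 2 * n) fun i => by push_cast; ring).le

/-- The enlargements are nested.  Private plumbing. [folklore] -/
private theorem marginBox_mono (P : ℕ) (m : ℕ) (a : Pt d) {n n' : ℕ} (h : n ≤ n') :
    (pbox (fun i => (m : ℤ) * a i - n) (fun i => (m : ℤ) * a i + 2 * m - 1 + n)).image (proj P) ⊆
      (pbox (fun i => (m : ℤ) * a i - n') (fun i => (m : ℤ) * a i + 2 * m - 1 + n')).image (proj P) := by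
  refine Finset.image_subset_image fun y hy => ?_
  rw [mem_pbox] at hy ⊢
  intro i
  have := hy i
  have hnn : (n : ℤ) ≤ n' := by exact_mod_cast h
  constructor <;> linarith [this.1, this.2]

/-! ## §3. The □′-sum of p. 9 by shells -/

/-- **THE □′-SUM BY SHELLS.**  p. 9 [PDF 9], verbatim: *"Next we sum over the cubes □′, and this sum is controlled by
the first exponential in (1.30)."* — KERNEL FORM: if nonnegative weights w(□′) ≤ 1 on the cubes of π_j of the scale-j
torus satisfy w(□′) ≤ r^{n+1} whenever □′ lies outside the enlargement by n of the cover cube □ (i.e. decay by a factor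
r ≤ 1/5 per cube of ξ-distance: w(□′) ≤ r^{n+1} off the enlargement of □ by n + 1 cubes of π_j, where the gap to □
is ≥ n + 1 cubes), then Σ_{□′∈π_j} w(□′) ≤ 1344·m⁴ (m = L^{k−j} = (L^jη)⁻¹; 1344 = 16·84 from
#(enlargement by n + 1) ≤ (2m + 2n + 2)⁴ ≤ 16m⁴(n + 2)⁴ and Σ(n + 2)⁴rⁿ ≤ 84).  The growth m⁴ = (L^jη)⁻⁴ is the scale-honest
□′-count of `B13Lemma1DepGather.gather_p9_dep`. [cite: Balaban1988RG2Cluster, p.9 (the sum over the cubes □′)] -/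
theorem shell_sum_le (m N : ℕ) [NeZero m] [NeZero N] (a : Pt 4) (w : TPt 4 (m * N) → ℝ) {r : ℝ}
    (hr0 : 0 ≤ r) (hr : r ≤ 1 / 5) (hw1 : ∀ q, w q ≤ 1)
    (hw : ∀ (n : ℕ) q, q ∉ (pbox (fun i => (m : ℤ) * a i - (n + 1 : ℕ))
      (fun i => (m : ℤ) * a i + 2 * m - 1 + (n + 1 : ℕ))).image (proj (m * N)) → w q ≤ r ^ (n + 1)) :
    ∑ q, w q ≤ 1344 * (m : ℝ) ^ 4 := by
  classical
  set E : ℕ → Finset (TPt 4 (m * N)) := fun n =>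
    (pbox (fun i => (m : ℤ) * a i - (n + 1 : ℕ)) (fun i => (m : ℤ) * a i + 2 * m - 1 + (n + 1 : ℕ))).image
      (proj (m * N)) with hE
  have hm1 : 1 ≤ m := Nat.pos_of_ne_zero (NeZero.ne m)
  -- E (mN) = univ
  have hEK : E (m * N) = Finset.univ := by
    simp only [hE]
    apply image_pbox_eq_univ
    intro i; push_cast; nlinarith
  have hEmono : ∀ {n n'}, n ≤ n' → E n ⊆ E n' := fun h => by
    simp only [hE]; exact marginBox_mono (m * N) m a (Nat.succ_le_succ h)
  -- the shell index
  set Nq : TPt 4 (m * N) → ℕ := fun q => ((Finset.range (m * N + 1)).filter (fun n => q ∉ E n)).card with hNq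
  have hS_sub : ∀ q, (Finset.range (m * N + 1)).filter (fun n => q ∉ E n) ⊆ Finset.range (m * N) := by
    intro q n hn
    rw [Finset.mem_filter, Finset.mem_range] at hn
    rw [Finset.mem_range]
    rcases Nat.lt_succ_iff_lt_or_eq.mp hn.1 with h | h
    · exact h
    · exact absurd (hEK ▸ Finset.mem_univ q : q ∈ E (m * N)) (h ▸ hn.2)
  have hNqK : ∀ q, Nq q ≤ m * N := fun q => by
    simpa using Finset.card_le_card (hS_sub q)
  have hdown : ∀ q {n n'}, n' ≤ n → n ∈ (Finset.range (m * N + 1)).filter (fun n => q ∉ E n) →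
      n' ∈ (Finset.range (m * N + 1)).filter (fun n => q ∉ E n) := by
    intro q n n' hle hn
    rw [Finset.mem_filter, Finset.mem_range] at hn ⊢
    exact ⟨lt_of_le_of_lt hle hn.1, fun h => hn.2 (hEmono hle h)⟩
  -- Claim A: q ∉ E n for n < Nq q
  have hA : ∀ q n, n < Nq q → q ∉ E n := by
    intro q n hn hqE
    have hsub : (Finset.range (m * N + 1)).filter (fun n => q ∉ E n) ⊆ Finset.range n := by
      intro n' hn'
      rw [Finset.mem_range]
      by_contra hge
      exact (Finset.mem_filter.mp (hdown q (not_lt.mp hge) hn')).2 hqE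
    have := Finset.card_le_card hsub
    simp only [Finset.card_range] at this
    exact absurd this (not_le.mpr hn)
  -- Claim B: q ∈ E (Nq q)
  have hB : ∀ q, q ∈ E (Nq q) := by
    intro q
    by_contra hq
    have hsub : Finset.range (Nq q + 1) ⊆ (Finset.range (m * N + 1)).filter (fun n => q ∉ E n) := by
      intro n hn
      rw [Finset.mem_range] at hn
      have hle : n ≤ Nq q := Nat.lt_succ_iff.mp hn
      rw [Finset.mem_filter, Finset.mem_range]
      exact ⟨Nat.lt_succ_of_le (hle.trans (hNqK q)), fun h => hq (hEmono hle h)⟩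
    have := Finset.card_le_card hsub
    simp only [Finset.card_range] at this
    exact absurd this (not_le.mpr (Nat.lt_succ_self _))
  -- w q ≤ r ^ Nq q
  have hwN : ∀ q, w q ≤ r ^ Nq q := by
    intro q
    rcases Nat.eq_zero_or_pos (Nq q) with h0 | hpos
    · rw [h0, pow_zero]; exact hw1 q
    · have h := hA q _ (Nat.sub_lt hpos one_pos)
      simp only [hE] at h
      have := hw (Nq q - 1) q h
      rwa [Nat.sub_add_cancel (show 1 ≤ Nq q from hpos)] at this
  -- fiberwise
  have hmaps : ∀ q ∈ (Finset.univ : Finset (TPt 4 (m * N))), Nq q ∈ Finset.range (m * N + 1) :=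
    fun q _ => Finset.mem_range.mpr (Nat.lt_succ_of_le (hNqK q))
  calc ∑ q, w q ≤ ∑ q, r ^ Nq q := Finset.sum_le_sum fun q _ => hwN q
    _ = ∑ n ∈ Finset.range (m * N + 1), ∑ q ∈ Finset.univ.filter (fun q => Nq q = n), r ^ Nq q :=
        (Finset.sum_fiberwise_of_maps_to hmaps _).symm
    _ = ∑ n ∈ Finset.range (m * N + 1), ((Finset.univ.filter (fun q => Nq q = n)).card : ℝ) * r ^ n := by
        refine Finset.sum_congr rfl fun n _ => ?_
        rw [Finset.sum_congr rfl fun q hq => by rw [(Finset.mem_filter.mp hq).2], Finset.sum_const, nsmul_eq_mul]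
    _ ≤ ∑ n ∈ Finset.range (m * N + 1), (((2 * m + 2 * (n + 1)) ^ 4 : ℕ) : ℝ) * r ^ n :=
        Finset.sum_le_sum fun n _ => by
          refine mul_le_mul_of_nonneg_right ?_ (pow_nonneg hr0 n)
          have h1 : (Finset.univ.filter (fun q => Nq q = n)).card ≤ (E n).card :=
            Finset.card_le_card fun q hq => by
              have := (Finset.mem_filter.mp hq).2
              rw [← this]; exact hB q
          have h2 : (E n).card ≤ (2 * m + 2 * (n + 1)) ^ 4 := by
            simp only [hE]; exact card_image_marginBox_le (m * N) m a (n + 1)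
          exact_mod_cast h1.trans h2
    _ ≤ ∑ n ∈ Finset.range (m * N + 1), 16 * (m : ℝ) ^ 4 * (((n : ℝ) + 2) ^ 4 * r ^ n) :=
        Finset.sum_le_sum fun n _ => by
          have hm : (1 : ℝ) ≤ m := by exact_mod_cast hm1
          have h3 : (((2 * m + 2 * (n + 1)) ^ 4 : ℕ) : ℝ) ≤ 16 * (m : ℝ) ^ 4 * ((n : ℝ) + 2) ^ 4 := by
            push_cast
            have e : 16 * (m : ℝ) ^ 4 * ((n : ℝ) + 2) ^ 4 = (2 * (m : ℝ) * ((n : ℝ) + 2)) ^ 4 := by ring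
            rw [e]
            apply pow_le_pow_left₀ (by positivity)
            nlinarith
          calc (((2 * m + 2 * (n + 1)) ^ 4 : ℕ) : ℝ) * r ^ n ≤ 16 * (m : ℝ) ^ 4 * ((n : ℝ) + 2) ^ 4 * r ^ n :=
                mul_le_mul_of_nonneg_right h3 (pow_nonneg hr0 n)
            _ = _ := by ring
    _ = 16 * (m : ℝ) ^ 4 * ∑ n ∈ Finset.range (m * N + 1), ((n : ℝ) + 2) ^ 4 * r ^ n := by rw [Finset.mul_sum]
    _ ≤ 16 * (m : ℝ) ^ 4 * 84 := mul_le_mul_of_nonneg_left (series_le (m * N + 1) hr0 hr) (by positivity)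
    _ = 1344 * (m : ℝ) ^ 4 := by ring

/-! ## §4. The □′-sum of the (I.3.7) chain in the shape consumed by the torus Lemma-1 theorems -/

/-- **THE □′-SUM OF p. 9, PROVED ON THE TORUS**: for the cover cube □ anchored at the π_k-cube ā and ANY function
`dist` on the cubes of π_j with dist(□′) ≥ (n + 1)·M whenever □′ lies outside the enlargement of □ by n + 1 cubes of
π_j, i.e. whenever the gap between □′ and □ is at least n + 1 cubes of π_j (`hdist`; the only property of print's
dist^{(ξ)}(□′, □) that is used; a cube of π_j has side M in ξ-units) and dist ≥ 0, under δ₀ ≥ 0 and δ₀M ≥ 2 log 5: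
Σ_{□′∈π_j} exp(−½δ₀dist(□′)) ≤ 1344·m⁴, m = L^{k−j}. [cite: Balaban1988RG2Cluster, p.9 (the sum over the cubes □′)] -/
theorem cubeSum_p9 (m N : ℕ) [NeZero m] [NeZero N] (a : Pt 4) {δ₀ M : ℝ} (hδ₀ : 0 ≤ δ₀)
    (h5 : 2 * Real.log 5 ≤ δ₀ * M) (dist : TPt 4 (m * N) → ℝ) (hdist0 : ∀ q, 0 ≤ dist q)
    (hdist : ∀ (n : ℕ) q, q ∉ (pbox (fun i => (m : ℤ) * a i - (n + 1 : ℕ))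
      (fun i => (m : ℤ) * a i + 2 * m - 1 + (n + 1 : ℕ))).image (proj (m * N)) → M * ((n : ℝ) + 1) ≤ dist q) :
    ∑ q, Real.exp (-((1 / 2) * δ₀ * dist q)) ≤ 1344 * (m : ℝ) ^ 4 := by
  have hr : Real.exp (-((1 / 2) * (δ₀ * M))) ≤ 1 / 5 := by
    have h1 : Real.exp (-((1 / 2) * (δ₀ * M))) ≤ Real.exp (-Real.log 5) := Real.exp_le_exp.mpr (by linarith)
    have h2 : Real.exp (-Real.log 5) = 1 / 5 := by
      rw [Real.exp_neg, Real.exp_log (by norm_num : (0 : ℝ) < 5), one_div]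
    rwa [h2] at h1
  refine shell_sum_le m N a (fun q => Real.exp (-((1 / 2) * δ₀ * dist q))) (Real.exp_pos _).le hr
    (fun q => ?_) (fun n q hq => ?_)
  · exact Real.exp_le_one_iff.mpr (by nlinarith [hdist0 q])
  · have h := hdist n q hq
    rw [← Real.exp_nat_mul]
    apply Real.exp_le_exp.mpr
    push_cast
    nlinarith [mul_le_mul_of_nonneg_left h hδ₀]

/-- **The hypothesis `hq'` of the torus Lemma-1 theorems DISCHARGED**: for every family `Sq'` of cubes of π_j =
`TPt 4 (L^{k−j}·N)` (j ≤ k) and every `dist` as in `cubeSum_p9`,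
Σ_{□′∈Sq'} exp(−½δ₀dist(□′)) ≤ 1344·((L^j(L^k)⁻¹)⁴)⁻¹ — O₂ = 1344. [cite: Balaban1988RG2Cluster, p.9 (the sum over the cubes □′)] -/
theorem cubeSum_p9_hq (L N k j : ℕ) [NeZero L] [NeZero N] (hjk : j ≤ k) (a : Pt 4) {δ₀ M : ℝ} (hδ₀ : 0 ≤ δ₀)
    (h5 : 2 * Real.log 5 ≤ δ₀ * M) (dist : TPt 4 (L ^ (k - j) * N) → ℝ) (hdist0 : ∀ q, 0 ≤ dist q)
    (hdist : ∀ (n : ℕ) q, q ∉ (pbox (fun i => ((L ^ (k - j) : ℕ) : ℤ) * a i - (n + 1 : ℕ))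
      (fun i => ((L ^ (k - j) : ℕ) : ℤ) * a i + 2 * ((L ^ (k - j) : ℕ) : ℤ) - 1 + (n + 1 : ℕ))).image
        (proj (L ^ (k - j) * N)) → M * ((n : ℝ) + 1) ≤ dist q)
    (Sq' : Finset (TPt 4 (L ^ (k - j) * N))) :
    ∑ q ∈ Sq', Real.exp (-((1 / 2) * δ₀ * dist q)) ≤ 1344 * (((L : ℝ) ^ j * ((L : ℝ) ^ k)⁻¹) ^ 4)⁻¹ := by
  have hL0 : (0 : ℝ) < L := by exact_mod_cast Nat.pos_of_ne_zero (NeZero.ne L)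
  have hℓ : (((L : ℝ) ^ j * ((L : ℝ) ^ k)⁻¹) ^ 4)⁻¹ = (((L ^ (k - j) : ℕ) : ℝ)) ^ 4 := by
    rw [Nat.cast_pow, ← Nat.add_sub_cancel' hjk, pow_add, Nat.add_sub_cancel' hjk, mul_inv, ← mul_assoc,
      mul_inv_cancel₀ (pow_ne_zero _ hL0.ne'), one_mul, inv_pow, inv_inv]
  rw [hℓ]
  exact (Finset.sum_le_univ_sum_of_nonneg fun q => (Real.exp_pos _).le).trans
    (cubeSum_p9 (L ^ (k - j)) N a hδ₀ h5 dist hdist0 hdist)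

end Literature.MathematicalPhysics.QuantumFieldTheory.Balaban1983to89.B13CubeSumTorus
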